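import Literature.Probability.Percolation.LongRangeTouched
import HarnessLib

/-!
# Long-range bond percolation on `ℤ`: the bridge bound

Topic `Literature/Probability/Percolation`; companion of `LongRangeModel.lean` (Duminil-Copin–
Garban–Tassion, AIHP 60 (2024), §2.4, proof of Lemma 3, last display:
`P[{x,y} is a bridge] ≤ (1 - e^{-βJ_{x,y}}) (P[0 ↔ ℤ ∖ B_R]² + |B_R|² e^{-β(K-2R)})`).

## Contents (all proved)

* `lt_edgeLen_of_mem_linkEdges`, `card_linkEdges_le` — a link between the two `R`-balls of a
  pair at distance `> 8K + 2R` has length `> 8K`, and there are at most `(2R+1)²` candidates;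
* `real_isLongBridge_le` — `P(bridge {x,y}) ≤ p_{xy} (θ₁² + (2R+1)² β'/K²)` for such pairs, from
  the bridge decomposition (`LongRangeBridges`), independence of disjoint supports, translation
  invariance and the union bound.

## References

* H. Duminil-Copin, C. Garban, V. Tassion, *Long-range models in 1D revisited*, Ann. Inst.
  H. Poincaré Probab. Statist. 60 (2024), arXiv:2011.04642: §2.4 (Thm. 1(ii), Lemma 3).
-/

namespace Literature.Probability.Percolation

open MeasureTheory SimpleGraph Literature.Probability.LatticeModels
open scoped ENNReal

/-- Edges of `linkEdges L R x y` are longer than `y - x - 2R` (one endpoint in each ball).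
[folklore] -/
theorem lt_edgeLen_of_mem_linkEdges {L R : ℕ} {x y : ℤ} {f : Sym2 ℤ} (hf : f ∈ linkEdges L R x y)
    {m : ℕ} (hm : (m : ℤ) + 2 * R < y - x) : m < edgeLen f := by
  obtain ⟨-, ⟨w, hwf, hw⟩, ⟨z, hzf, hz⟩, -⟩ := hf
  induction f using Sym2.ind with
  | h u v =>
    rw [lt_edgeLen_mk_iff]
    rcases Sym2.mem_iff.1 hwf with rfl | rfl <;> rcases Sym2.mem_iff.1 hzf with rfl | rfl <;> omega

/-- **The bridge bound** (DGT20, proof of Lemma 3, last display: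
`P[{x,y} is a bridge] ≤ (1 - e^{-βJ_{x,y}}) (P[0 ↔ ℤ ∖ B_R]² + |B_R|² e^{-β(K-2R)}) ≤ (1 -
e^{-βJ_{x,y}}) θ²`). Our rendering, for a pair at distance `> 8K + 2R` (the jump pairs of the
block lemma), with `K_d ≤ β'/d²` beyond `K` and `P(0 exits its R-ball) ≤ θ₁`:
`P(bridge {x,y}) ≤ p_{xy} (θ₁² + (2R+1)² β'/K²)` — the edge is independent of the rest, the two
`exitAvoiding` events are independent of each other and each bounded by the exit probability
(translation invariance), and a link between the two balls costs at most `(2R+1)²` edges of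
length `> 8K`. [cite: DuminilcopinGarbanTassion2024, §2.4 (proof of Lemma 3)] -/
theorem real_isLongBridge_le {K : ℕ → unitInterval} {β' θ₁ : ℝ} (hβ : 0 ≤ β') {k L R : ℕ}
    (hdecay : ∀ n : ℕ, k < n → (K n : ℝ) ≤ β' / (n : ℝ) ^ 2)
    (hθ : (lrMeasure K).real {ω | exits R ω 0} ≤ θ₁) (hL : 2 * R ≤ L) (hk : 1 ≤ k)
    {x y : ℤ} (hxy : (8 * k + 2 * R : ℤ) < y - x) :
    (lrMeasure K).real {ω | IsLongBridge L R ω x y} ≤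
      (edgeProb K s(x, y) : ℝ) *
        (θ₁ ^ 2 + ((2 * R + 1) * (2 * R + 1) : ℕ) * (β' / (k : ℝ) ^ 2)) := by
  have h2R : (2 * R : ℤ) < y - x ∨ (2 * R : ℤ) < x - y := Or.inl (by omega)
  have h2R' : (2 * R : ℤ) < x - y ∨ (2 * R : ℤ) < y - x := Or.inr (by omega)
  -- the events and their determining sets
  set E : Set (BondConfig ℤ) := {ω | s(x, y) ∈ ω} with hE
  set A := exitAvoiding L R x y with hA
  set A' := exitAvoiding L R y x with hA'
  set D := linked L R x y with hD
  have hEd : DeterminedBy E ({s(x, y)} : Set (Sym2 ℤ)) := by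
    rw [determinedBy_iff]
    intro ω ω' h
    have := Set.ext_iff.1 h s(x, y)
    simp only [Set.mem_inter_iff, Set.mem_singleton_iff, and_true] at this
    exact this
  have hEm : MeasurableSet E := measurableSet_mem _
  have hAd : DeterminedBy A (exitAvoidingEdges L R x y) := determinedBy_exitAvoiding hL h2R
  have hA'd : DeterminedBy A' (exitAvoidingEdges L R y x) := determinedBy_exitAvoiding hL h2R'
  have hAm : MeasurableSet A := hAd.measurableSet_of_finite (exitAvoidingEdges_finite L R x y)
  have hA'm : MeasurableSet A' := hA'd.measurableSet_of_finite (exitAvoidingEdges_finite L R y x)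
  have hDd : DeterminedBy D (linkEdges L R x y) := determinedBy_linked L R x y
  have hDm : MeasurableSet D := hDd.measurableSet_of_finite (linkEdges_finite L R x y)
  -- independence
  have hpE : (lrMeasure K).real E = edgeProb K s(x, y) := prodBernoulli_real_setOf_mem _ _
  have hind1 : (lrMeasure K).real (E ∩ (A ∩ A')) =
      (lrMeasure K).real E * (lrMeasure K).real (A ∩ A') := by
    refine prodBernoulli_real_inter_of_determinedBy_finite _ (Set.finite_singleton _)
      ((exitAvoidingEdges_finite L R x y).union (exitAvoidingEdges_finite L R y x)) ?_ hEd
      (DeterminedBy.inter (hAd.mono Set.subset_union_left) (hA'd.mono Set.subset_union_right))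
      hEm (hAm.inter hA'm)
    rw [Set.disjoint_singleton_left]
    rintro (h | h)
    · exact mk_not_mem_exitAvoidingEdges L R x y h
    · exact mk_not_mem_exitAvoidingEdges' L R x y h
  have hind2 : (lrMeasure K).real (A ∩ A') = (lrMeasure K).real A * (lrMeasure K).real A' :=
    prodBernoulli_real_inter_of_determinedBy_finite _ (exitAvoidingEdges_finite L R x y)
      (exitAvoidingEdges_finite L R y x) (disjoint_exitAvoidingEdges L R x y) hAd hA'd hAm hA'm
  have hind3 : (lrMeasure K).real (E ∩ D) = (lrMeasure K).real E * (lrMeasure K).real D := by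
    refine prodBernoulli_real_inter_of_determinedBy_finite _ (Set.finite_singleton _)
      (linkEdges_finite L R x y) ?_ hEd hDd hEm hDm
    rw [Set.disjoint_singleton_left]
    exact mk_not_mem_linkEdges L R x y
  -- the exit bounds
  have hexit : ∀ {B : Set (BondConfig ℤ)} (z : ℤ), B ⊆ {ω | exits R ω z} →
      (lrMeasure K).real B ≤ θ₁ := by
    intro B z hB
    refine le_trans (measureReal_mono hB) ?_
    rw [lrMeasure_real_exits K R z]
    exact hθ
  have hAle : (lrMeasure K).real A ≤ θ₁ := hexit x (exitAvoiding_subset_exits L R x y)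
  have hA'le : (lrMeasure K).real A' ≤ θ₁ := hexit y (exitAvoiding_subset_exits L R y x)
  -- the link bound
  have hDle : (lrMeasure K).real D ≤ ((2 * R + 1) * (2 * R + 1) : ℕ) * (β' / (k : ℝ) ^ 2) := by
    have hDeq : D = {ω | ∃ f ∈ (linkEdges_finite L R x y).toFinset, f ∈ ω} := by
      rw [hD, linked]; ext ω; simp [Set.Finite.mem_toFinset]
    rw [hDeq, lrMeasure]
    refine le_trans (prodBernoulli_real_exists_mem_le_sum _ _) ?_
    refine le_trans (Finset.sum_le_card_nsmul _ _ (β' / (k : ℝ) ^ 2) fun f hf => ?_) ?_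
    · rw [Set.Finite.mem_toFinset] at hf
      have hlen : 8 * k < edgeLen f := lt_edgeLen_of_mem_linkEdges hf (by push_cast; omega)
      have hlen' : k < edgeLen f := by omega
      change (K (edgeLen f) : ℝ) ≤ _
      refine le_trans (hdecay _ hlen') (div_le_div_of_nonneg_left hβ (by positivity) ?_)
      have : (k : ℝ) ≤ edgeLen f := by exact_mod_cast hlen'.le
      nlinarith
    · rw [nsmul_eq_mul]
      refine mul_le_mul_of_nonneg_right ?_ (by positivity)
      exact_mod_cast card_linkEdges_le L R (by omega)
  -- assemble
  have hsub : {ω | IsLongBridge L R ω x y} ⊆ E ∩ (A ∩ A') ∪ E ∩ D := by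
    intro ω hω
    have := isLongBridge_subset L R x y hω
    rwa [Set.inter_union_distrib_left] at this
  have hp0 : 0 ≤ (edgeProb K s(x, y) : ℝ) := (edgeProb K s(x, y)).2.1
  calc (lrMeasure K).real {ω | IsLongBridge L R ω x y}
      ≤ (lrMeasure K).real (E ∩ (A ∩ A') ∪ E ∩ D) := measureReal_mono hsub
    _ ≤ (lrMeasure K).real (E ∩ (A ∩ A')) + (lrMeasure K).real (E ∩ D) :=
        measureReal_union_le _ _
    _ = (edgeProb K s(x, y) : ℝ) * ((lrMeasure K).real A * (lrMeasure K).real A' +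
          (lrMeasure K).real D) := by rw [hind1, hind2, hind3, hpE]; ring
    _ ≤ (edgeProb K s(x, y) : ℝ) *
        (θ₁ ^ 2 + ((2 * R + 1) * (2 * R + 1) : ℕ) * (β' / (k : ℝ) ^ 2)) := by
        refine mul_le_mul_of_nonneg_left (add_le_add ?_ hDle) hp0
        rw [sq]
        exact mul_le_mul hAle hA'le measureReal_nonneg (measureReal_nonneg.trans hAle)

end Literature.Probability.Percolation
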